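import Mathlib
import Summits.Ventures.PercRepro2.HCov
import Summits.Ventures.PercRepro2.DiagBA3
import Summits.Ventures.PercRepro2.A3RootEdge
import Summits.Ventures.PercRepro2.RootEdgeBern
import Summits.Ventures.PercRepro2.HCovPlusQuartic
import Summits.Ventures.PercRepro2.QuarticRootCross
import Summits.Ventures.PercRepro2.QuarticRootCrossOL
import Summits.Ventures.PercRepro2.QuarticRootSlack
import Summits.Ventures.PercRepro2.QuarticRootSlackSign
import Summits.Ventures.PercRepro2.QuarticRootSplit
import Summits.Ventures.PercRepro2.QuarticRootSigned

/-!
# THE BETWEEN-WORLD PART OF THE KERNEL PAYS THE PRODUCT TERM OF THE ROOT-EDGE FACE — THE WITHIN-FORM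
(blind cell PercRepro2, p5 g19; `proofs/P5-OEDGE.md` §25 addendum 2, `proofs/P5-CPOLARROAD.md` §8 addendum 2)

At a root edge `e = {a₁, a₃}`, split the closed-pin kernel `Gc₀` over the worlds `PD / T / T′` of `Q`
(law of total covariance for `Cov_Q(σ_b, F)`): `Gc₀ = D₀·Q₀·[within + Q₀·Between]`, where
`within = D₀·(Cov_PD(σ_b, σ_o) − Cov_PD(1_{b∈U}, 1_{o∈U})) − 2t′·Cov_{T′}(σ_b, 1_{oH}) + 2t·Cov_T(σ_b, 1_{oL})`
and `Between = Σ_{w < w′} (w·w′/Q₀²)·(E[σ_b|w] − E[σ_b|w′])·(E[F|w] − E[F|w′])` — every between-pair a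
product of an `o`-deficit and a `b`-deficit. The product term `2·δ_oH·[Q₀·δ_bH + Q₁·(G1 + G2)]` of the
signed form (`QuarticRootSigned`) is paid by `Q₁²·D₀·Q₀²·Between` with an EXPLICIT non-negative surplus:

* **`Gc0_within_form`** (division-free, multiplied by `D₀·t·t′`):
  `D₀·t·t′·Q₁²·Gc₀ = Q₁²·KW + D₀·t·t′·NEG + D₀·[2·Q₀·t·δ_oH·(D₀·δ_bH + Q₁·δ′_bL) + 2·Q₁²·t′·δ_oL^T·(G1 + G2)]`,
  `KW = D₀·t·t′·D₀·Q₀·within` written in the closed-pin pattern masses (pure `ring` after `Qsplit`);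
* **`surplus_nonneg_root`**: the surplus is `≥ 0` (the deficit lemmas `DiagBA3.T'oH_mul_D_le`,
  `PDoL_mul_T'_le`, `ToL_mul_D_le` and the BHK pieces `G1, G2 ≥ 0` of `slackBm_nonneg_root`);
* **`H2_nonneg_root_of_within`**: the typed target — in the non-degenerate case `0 < D₀, t, t′, Q₀`,
  `0 ≤ Q₁²·KW + surplus + D₀·t·t′·(Q₀·A·slackBm + 2·Q₁·df·δ_oL^T)` gives `0 ≤ H2`.
* **`NEG_nonneg_root`**, **`between_part_nonneg_root`** (appended): the product term is `≥ 0` and so is the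
  between-world part of the kernel, `Q₁²·KW ≤ D₀·t·t′·Q₁²·Gc₀` — the «nonnegative between-world piece» is a theorem.

READING: the root-edge face of record is EQUIVALENT to «the within-world covariance part of the kernel is
covered by explicit products of deficits»; it holds outright wherever `within ≥ 0`, and its open content
lies exactly on the residual class `within < 0` (the subject of S4). Census: the identity exact on
307 adversarial (N2) witnesses + 300 random lines; `within < 0` on 2 / 307 and 31 / 450 random lines.
-/

namespace Summit.Ventures.PercRepro2

open UnionCluster CovForm CovForm.EdgeLine CovForm.RootEdge CovForm.A3Fibre HCovPlusQuartic

namespace QuarticRootCross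

section Within

variable {V : Type*} {E : Type*} [Fintype V] [DecidableEq V] [Fintype E] [DecidableEq E]
  {R : Type*} [Field R] [LinearOrder R] [IsStrictOrderedRing R]

variable {ends : E → Sym2 V} {e : E} {a₁ a₃ : V}

omit [Fintype V] in
/-- **The within-form of the closed-pin kernel** (division-free): `D₀·t·t′·Q₁²·Gc₀ = Q₁²·KW + D₀·t·t′·NEG
+ surplus`, with `KW` the within-world covariance part, `NEG = 2·δ_oH·[Q₀·δ_bH + Q₁·(G1 + G2)]` the product
term of the signed form and `surplus = D₀·[2·Q₀·t·δ_oH·(D₀·δ_bH + Q₁·δ′_bL) + 2·Q₁²·t′·δ_oL^T·(G1 + G2)]`. -/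
theorem Gc0_within_form (p : E → R) (hends : ends e = s(a₁, a₃)) (o a₂ b : V) :
    prob (Function.update p e 0) (PDEvent ends a₁ a₂ a₃) * prob (Function.update p e 0) (TEvent ends a₁ a₂ a₃) * prob (Function.update p e 0) (TEvent ends a₂ a₁ a₃) * prob (Function.update p e 1) (avoidAll ends a₂ {a₁}) ^ 2 * Gc (Function.update p e 0) ends o a₁ a₂ a₃ b =
      prob (Function.update p e 1) (avoidAll ends a₂ {a₁}) ^ 2 * prob (Function.update p e 0) (PDEvent ends a₁ a₂ a₃) * prob (Function.update p e 0) (avoidAll ends a₂ {a₁}) * (prob (Function.update p e 0) (TEvent ends a₁ a₂ a₃) * prob (Function.update p e 0) (TEvent ends a₂ a₁ a₃) * (prob (Function.update p e 0) (PDEvent ends a₁ a₂ a₃) * (prob (Function.update p e 0) (PDEvent ends a₁ a₂ a₃ ∩ (connEvent ends a₁ o ∩ connEvent ends a₁ b)) + prob (Function.update p e 0) (PDEvent ends a₁ a₂ a₃ ∩ (connEvent ends a₂ o ∩ connEvent ends a₂ b)) - prob (Function.update p e 0) (PDEvent ends a₁ a₂ a₃ ∩ (connEvent ends a₂ o ∩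 connEvent ends a₁ b)) - prob (Function.update p e 0) (PDEvent ends a₁ a₂ a₃ ∩ (connEvent ends a₁ o ∩ connEvent ends a₂ b))) - (prob (Function.update p e 0) (PDEvent ends a₁ a₂ a₃ ∩ connEvent ends a₁ b) - prob (Function.update p e 0) (PDEvent ends a₁ a₂ a₃ ∩ connEvent ends a₂ b)) * (prob (Function.update p e 0) (PDEvent ends a₁ a₂ a₃ ∩ connEvent ends a₁ o) - prob (Function.update p e 0) (PDEvent ends a₁ a₂ a₃ ∩ connEvent ends a₂ o)) - prob (Function.update p e 0) (PDEvent ends a₁ a₂ a₃) * (prob (Function.update p e 0) (PDEvent ends a₁ a₂ a₃ ∩ (connEvent ends a₁ o ∩ connEvent ends a₁ b)) + prob (Function.update p e 0) (PDEvent ends a₁ a₂ a₃ ∩ (connEvent ends a₂ o ∩ connEvent ends a₂ b)) + prob (Function.update p e 0) (PDEvent ends a₁ a₂ a₃ ∩ (connEvent ends a₂ o ∩ connEvent ends a₁ b)) + prob (Function.update p e 0) (PDEvent ends a₁ a₂ a₃ ∩ (connEvent ends a₁ o ∩ connEvent ends a₂ b))) + (prob (Function.update p e 0) (PDEvent ends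 a₁ a₂ a₃ ∩ connEvent ends a₁ b) + prob (Function.update p e 0) (PDEvent ends a₁ a₂ a₃ ∩ connEvent ends a₂ b)) * (prob (Function.update p e 0) (PDEvent ends a₁ a₂ a₃ ∩ connEvent ends a₁ o) + prob (Function.update p e 0) (PDEvent ends a₁ a₂ a₃ ∩ connEvent ends a₂ o))) - 2 * prob (Function.update p e 0) (PDEvent ends a₁ a₂ a₃) * prob (Function.update p e 0) (TEvent ends a₁ a₂ a₃) * (prob (Function.update p e 0) (TEvent ends a₂ a₁ a₃) * (prob (Function.update p e 0) (TEvent ends a₂ a₁ a₃ ∩ (connEvent ends a₂ o ∩ connEvent ends a₁ b)) - prob (Function.update p e 0) (TEvent ends a₂ a₁ a₃ ∩ (connEvent ends a₂ o ∩ connEvent ends a₂ b))) - (prob (Function.update p e 0) (TEvent ends a₂ a₁ a₃ ∩ connEvent ends a₁ b) - prob (Function.update p e 0) (TEvent ends a₂ a₁ a₃ ∩ connEvent ends a₂ b)) * prob (Function.update p e 0) (TEvent ends a₂ a₁ a₃ ∩ connEvent ends a₂ o)) + 2 * prob (Function.update p e 0) (PDEvent ends a₁ a₂ a₃) * prob (Function.update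 p e 0) (TEvent ends a₂ a₁ a₃) * (prob (Function.update p e 0) (TEvent ends a₁ a₂ a₃) * (prob (Function.update p e 0) (TEvent ends a₁ a₂ a₃ ∩ (connEvent ends a₁ o ∩ connEvent ends a₁ b)) - prob (Function.update p e 0) (TEvent ends a₁ a₂ a₃ ∩ (connEvent ends a₁ o ∩ connEvent ends a₂ b))) - (prob (Function.update p e 0) (TEvent ends a₁ a₂ a₃ ∩ connEvent ends a₁ b) - prob (Function.update p e 0) (TEvent ends a₁ a₂ a₃ ∩ connEvent ends a₂ b)) * prob (Function.update p e 0) (TEvent ends a₁ a₂ a₃ ∩ connEvent ends a₁ o))) +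
        prob (Function.update p e 0) (PDEvent ends a₁ a₂ a₃) * prob (Function.update p e 0) (TEvent ends a₁ a₂ a₃) * prob (Function.update p e 0) (TEvent ends a₂ a₁ a₃) * (2 * (prob (Function.update p e 0) (PDEvent ends a₁ a₂ a₃ ∩ connEvent ends a₂ o) * prob (Function.update p e 0) (TEvent ends a₂ a₁ a₃) - prob (Function.update p e 0) (PDEvent ends a₁ a₂ a₃) * prob (Function.update p e 0) (TEvent ends a₂ a₁ a₃ ∩ connEvent ends a₂ o)) * (prob (Function.update p e 0) (avoidAll ends a₂ {a₁}) * (prob (Function.update p e 0) (TEvent ends a₂ a₁ a₃) * prob (Function.update p e 0) (PDEvent ends a₁ a₂ a₃ ∩ connEvent ends a₂ b) - prob (Function.update p e 0) (PDEvent ends a₁ a₂ a₃) * prob (Function.update p e 0) (TEvent ends a₂ a₁ a₃ ∩ connEvent ends a₂ b)) + prob (Function.update p e 1) (avoidAll ends a₂ {a₁}) * ((prob (Function.update p e 0) (TEvent ends a₁ a₂ a₃ ∩ connEvent ends a₂ b) * (prob (Function.update p e 0) (PDEvent ends a₁ a₂ a₃) + prob (Function.update p e 0) (TEvent ends a₂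 a₁ a₃)) - prob (Function.update p e 0) (TEvent ends a₁ a₂ a₃) * (prob (Function.update p e 0) (PDEvent ends a₁ a₂ a₃ ∩ connEvent ends a₂ b) + prob (Function.update p e 0) (TEvent ends a₂ a₁ a₃ ∩ connEvent ends a₂ b))) + (prob (Function.update p e 0) (TEvent ends a₁ a₂ a₃) * (prob (Function.update p e 0) (PDEvent ends a₁ a₂ a₃ ∩ connEvent ends a₁ b) + prob (Function.update p e 0) (TEvent ends a₂ a₁ a₃ ∩ connEvent ends a₁ b)) - prob (Function.update p e 0) (TEvent ends a₁ a₂ a₃ ∩ connEvent ends a₁ b) * (prob (Function.update p e 0) (PDEvent ends a₁ a₂ a₃) + prob (Function.update p e 0) (TEvent ends a₂ a₁ a₃)))))) +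
        prob (Function.update p e 0) (PDEvent ends a₁ a₂ a₃) * (2 * prob (Function.update p e 0) (avoidAll ends a₂ {a₁}) * prob (Function.update p e 0) (TEvent ends a₁ a₂ a₃) * (prob (Function.update p e 0) (PDEvent ends a₁ a₂ a₃ ∩ connEvent ends a₂ o) * prob (Function.update p e 0) (TEvent ends a₂ a₁ a₃) - prob (Function.update p e 0) (PDEvent ends a₁ a₂ a₃) * prob (Function.update p e 0) (TEvent ends a₂ a₁ a₃ ∩ connEvent ends a₂ o)) * (prob (Function.update p e 0) (PDEvent ends a₁ a₂ a₃) * (prob (Function.update p e 0) (TEvent ends a₂ a₁ a₃) * prob (Function.update p e 0) (PDEvent ends a₁ a₂ a₃ ∩ connEvent ends a₂ b) - prob (Function.update p e 0) (PDEvent ends a₁ a₂ a₃) * prob (Function.update p e 0) (TEvent ends a₂ a₁ a₃ ∩ connEvent ends a₂ b)) + prob (Function.update p e 1) (avoidAll ends a₂ {a₁}) * (prob (Function.update p e 0) (PDEvent ends a₁ a₂ a₃) * prob (Function.update p e 0) (TEvent ends a₂ a₁ a₃ ∩ connEvent ends a₁ b) - prob (Function.update p e 0) (PDEvent ends a₁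 a₂ a₃ ∩ connEvent ends a₁ b) * prob (Function.update p e 0) (TEvent ends a₂ a₁ a₃))) + 2 * prob (Function.update p e 1) (avoidAll ends a₂ {a₁}) ^ 2 * prob (Function.update p e 0) (TEvent ends a₂ a₁ a₃) * (prob (Function.update p e 0) (PDEvent ends a₁ a₂ a₃ ∩ connEvent ends a₁ o) * prob (Function.update p e 0) (TEvent ends a₁ a₂ a₃) - prob (Function.update p e 0) (PDEvent ends a₁ a₂ a₃) * prob (Function.update p e 0) (TEvent ends a₁ a₂ a₃ ∩ connEvent ends a₁ o)) * ((prob (Function.update p e 0) (TEvent ends a₁ a₂ a₃ ∩ connEvent ends a₂ b) * (prob (Function.update p e 0) (PDEvent ends a₁ a₂ a₃) + prob (Function.update p e 0) (TEvent ends a₂ a₁ a₃)) - prob (Function.update p e 0) (TEvent ends a₁ a₂ a₃) * (prob (Function.update p e 0) (PDEvent ends a₁ a₂ a₃ ∩ connEvent ends a₂ b) + prob (Function.update p e 0) (TEvent ends a₂ a₁ a₃ ∩ connEvent ends a₂ b))) + (prob (Function.update p e 0) (TEvent ends a₁ a₂ a₃) * (prob (Function.update p e 0) (PDEvent ends a₁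 a₂ a₃ ∩ connEvent ends a₁ b) + prob (Function.update p e 0) (TEvent ends a₂ a₁ a₃ ∩ connEvent ends a₁ b)) - prob (Function.update p e 0) (TEvent ends a₁ a₂ a₃ ∩ connEvent ends a₁ b) * (prob (Function.update p e 0) (PDEvent ends a₁ a₂ a₃) + prob (Function.update p e 0) (TEvent ends a₂ a₁ a₃))))) := by
  unfold Gc DEF EQbo EQb3 EQb3o EQo EQ3 EQ3o PDb PDbo Do
  rw [gap_eq_Q, prob_one_Q_root_split p hends a₂, Qsplit (Function.update p e 0) ends a₁ a₂ a₃ (connEvent ends a₁ o ∩ connEvent ends a₁ b),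
    Qsplit (Function.update p e 0) ends a₁ a₂ a₃ (connEvent ends a₂ o ∩ connEvent ends a₂ b),
    Qsplit (Function.update p e 0) ends a₁ a₂ a₃ (connEvent ends a₂ o ∩ connEvent ends a₁ b),
    Qsplit (Function.update p e 0) ends a₁ a₂ a₃ (connEvent ends a₁ o ∩ connEvent ends a₂ b),
    Qsplit (Function.update p e 0) ends a₁ a₂ a₃ (connEvent ends a₁ o),
    Qsplit (Function.update p e 0) ends a₁ a₂ a₃ (connEvent ends a₂ o),
    Qsplit (Function.update p e 0) ends a₁ a₂ a₃ (connEvent ends a₁ b),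
    Qsplit (Function.update p e 0) ends a₁ a₂ a₃ (connEvent ends a₂ b),
    Qsplit_univ (Function.update p e 0) ends a₁ a₂ a₃]
  ring

/-- **The surplus is non-negative**: `0 ≤ D₀·[2·Q₀·t·δ_oH·(D₀·δ_bH + Q₁·δ′_bL) + 2·Q₁²·t′·δ_oL^T·(G1 + G2)]`
— the deficits `δ_oH, δ_bH, δ′_bL, δ_oL^T ≥ 0` (BHK) and the pieces `G1, G2 ≥ 0` of `slackBm`. -/
theorem surplus_nonneg_root (p : E → R) (hp : IsProbVec p) (o a₂ b : V) :
    0 ≤ prob (Function.update p e 0) (PDEvent ends a₁ a₂ a₃) * (2 * prob (Function.update p e 0) (avoidAll ends a₂ {a₁}) * prob (Function.update p e 0) (TEvent ends a₁ a₂ a₃) * (prob (Function.update p e 0) (PDEvent ends a₁ a₂ a₃ ∩ connEvent ends a₂ o) * prob (Function.update p e 0) (TEvent ends a₂ a₁ a₃) - prob (Function.update p e 0) (PDEvent ends a₁ a₂ a₃) * prob (Function.update p e 0) (TEvent ends a₂ a₁ a₃ ∩ connEvent ends a₂ o)) * (prob (Function.update p e 0) (PDEvent ends a₁ a₂ a₃)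 * (prob (Function.update p e 0) (TEvent ends a₂ a₁ a₃) * prob (Function.update p e 0) (PDEvent ends a₁ a₂ a₃ ∩ connEvent ends a₂ b) - prob (Function.update p e 0) (PDEvent ends a₁ a₂ a₃) * prob (Function.update p e 0) (TEvent ends a₂ a₁ a₃ ∩ connEvent ends a₂ b)) + prob (Function.update p e 1) (avoidAll ends a₂ {a₁}) * (prob (Function.update p e 0) (PDEvent ends a₁ a₂ a₃) * prob (Function.update p e 0) (TEvent ends a₂ a₁ a₃ ∩ connEvent ends a₁ b) - prob (Function.update p e 0) (PDEvent ends a₁ a₂ a₃ ∩ connEvent ends a₁ b) * prob (Function.update p e 0) (TEvent ends a₂ a₁ a₃))) + 2 * prob (Function.update p e 1) (avoidAll ends a₂ {a₁}) ^ 2 * prob (Function.update p e 0) (TEvent ends a₂ a₁ a₃) * (prob (Function.update p e 0) (PDEvent ends a₁ a₂ a₃ ∩ connEvent ends a₁ o) * prob (Function.update p e 0) (TEvent ends a₁ a₂ a₃) - prob (Function.update p e 0) (PDEvent ends a₁ a₂ a₃) * prob (Function.update p e 0) (TEvent ends a₁ a₂ a₃ ∩ connEvent ends a₁ o)) * ((prob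 (Function.update p e 0) (TEvent ends a₁ a₂ a₃ ∩ connEvent ends a₂ b) * (prob (Function.update p e 0) (PDEvent ends a₁ a₂ a₃) + prob (Function.update p e 0) (TEvent ends a₂ a₁ a₃)) - prob (Function.update p e 0) (TEvent ends a₁ a₂ a₃) * (prob (Function.update p e 0) (PDEvent ends a₁ a₂ a₃ ∩ connEvent ends a₂ b) + prob (Function.update p e 0) (TEvent ends a₂ a₁ a₃ ∩ connEvent ends a₂ b))) + (prob (Function.update p e 0) (TEvent ends a₁ a₂ a₃) * (prob (Function.update p e 0) (PDEvent ends a₁ a₂ a₃ ∩ connEvent ends a₁ b) + prob (Function.update p e 0) (TEvent ends a₂ a₁ a₃ ∩ connEvent ends a₁ b)) - prob (Function.update p e 0) (TEvent ends a₁ a₂ a₃ ∩ connEvent ends a₁ b) * (prob (Function.update p e 0) (PDEvent ends a₁ a₂ a₃) + prob (Function.update p e 0) (TEvent ends a₂ a₁ a₃))))) := by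
  have hp₀ : IsProbVec (Function.update p e 0) := hp.update e le_rfl zero_le_one
  have hd := prob_nonneg hp₀ (PDEvent ends a₁ a₂ a₃)
  have ht := prob_nonneg hp₀ (TEvent ends a₁ a₂ a₃)
  have htp := prob_nonneg hp₀ (TEvent ends a₂ a₁ a₃)
  have hQ0 := prob_nonneg hp₀ (avoidAll ends a₂ {a₁})
  have hQ1 := prob_nonneg (hp.update e zero_le_one le_rfl : IsProbVec (Function.update p e 1)) (avoidAll ends a₂ {a₁})
  -- δ_oH ≥ 0
  have hoH := DiagBA3.T'oH_mul_D_le (Function.update p e 0) hp₀ ends o a₁ a₂ a₃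
  -- δ_bH ≥ 0
  have hbH := DiagBA3.T'oH_mul_D_le (Function.update p e 0) hp₀ ends b a₁ a₂ a₃
  -- δ′_bL ≥ 0
  have hbL := PDoL_mul_T'_le (Function.update p e 0) hp₀ ends b a₁ a₂ a₃
  -- δ_oL^T ≥ 0
  have hoLT := ToL_mul_D_le (Function.update p e 0) hp₀ ends o a₁ a₂ a₃
  -- G1 ≥ 0 (BHK 1.3 on `C₂` for `b`, `a₃`), as in `slackBm_nonneg_root`
  have G1 := QbH_mul_T_le (Function.update p e 0) hp₀ ends a₁ a₂ a₃ b
  rw [Qsplit_univ (Function.update p e 0) ends a₁ a₂ a₃,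
    Qsplit (Function.update p e 0) ends a₁ a₂ a₃ (connEvent ends a₂ b)] at G1
  -- G2 ≥ 0 (BHK 1.4 for `{b ∈ C₁}`, `{a₃ ∈ C₂}`)
  have G2 := A3Inactive.bLoH_mul_Q_le (Function.update p e 0) hp₀ ends a₃ a₁ a₂ b
  rw [Q_inter_conn_a2_a3_inter ends a₁ a₂ a₃ (connEvent ends a₁ b),
    Qsplit_univ (Function.update p e 0) ends a₁ a₂ a₃,
    Qsplit (Function.update p e 0) ends a₁ a₂ a₃ (connEvent ends a₁ b)] at G2
  have eT : avoidAll ends a₂ {a₁} ∩ connEvent ends a₂ a₃ = TEvent ends a₁ a₂ a₃ := by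
    rw [TEvent, avoidAll_eq_compl]
  rw [eT] at G2
  have h1 : 0 ≤ (prob (Function.update p e 0) (PDEvent ends a₁ a₂ a₃ ∩ connEvent ends a₂ o) * prob (Function.update p e 0) (TEvent ends a₂ a₁ a₃) - prob (Function.update p e 0) (PDEvent ends a₁ a₂ a₃) * prob (Function.update p e 0) (TEvent ends a₂ a₁ a₃ ∩ connEvent ends a₂ o)) := by linarith [hoH]
  have h2 : 0 ≤ (prob (Function.update p e 0) (TEvent ends a₂ a₁ a₃) * prob (Function.update p e 0) (PDEvent ends a₁ a₂ a₃ ∩ connEvent ends a₂ b) - prob (Function.update p e 0) (PDEvent ends a₁ a₂ a₃) * prob (Function.update p e 0) (TEvent ends a₂ a₁ a₃ ∩ connEvent ends a₂ b)) := by linarith [hbH]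
  have h3 : 0 ≤ (prob (Function.update p e 0) (PDEvent ends a₁ a₂ a₃) * prob (Function.update p e 0) (TEvent ends a₂ a₁ a₃ ∩ connEvent ends a₁ b) - prob (Function.update p e 0) (PDEvent ends a₁ a₂ a₃ ∩ connEvent ends a₁ b) * prob (Function.update p e 0) (TEvent ends a₂ a₁ a₃)) := by linarith [hbL]
  have h4 : 0 ≤ (prob (Function.update p e 0) (PDEvent ends a₁ a₂ a₃ ∩ connEvent ends a₁ o) * prob (Function.update p e 0) (TEvent ends a₁ a₂ a₃) - prob (Function.update p e 0) (PDEvent ends a₁ a₂ a₃) * prob (Function.update p e 0) (TEvent ends a₁ a₂ a₃ ∩ connEvent ends a₁ o)) := by linarith [hoLT]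
  have h5 : 0 ≤ (prob (Function.update p e 0) (TEvent ends a₁ a₂ a₃ ∩ connEvent ends a₂ b) * (prob (Function.update p e 0) (PDEvent ends a₁ a₂ a₃) + prob (Function.update p e 0) (TEvent ends a₂ a₁ a₃)) - prob (Function.update p e 0) (TEvent ends a₁ a₂ a₃) * (prob (Function.update p e 0) (PDEvent ends a₁ a₂ a₃ ∩ connEvent ends a₂ b) + prob (Function.update p e 0) (TEvent ends a₂ a₁ a₃ ∩ connEvent ends a₂ b))) := by linarith [G1]
  have h6 : 0 ≤ (prob (Function.update p e 0) (TEvent ends a₁ a₂ a₃) * (prob (Function.update p e 0) (PDEvent ends a₁ a₂ a₃ ∩ connEvent ends a₁ b) + prob (Function.update p e 0) (TEvent ends a₂ a₁ a₃ ∩ connEvent ends a₁ b)) - prob (Function.update p e 0) (TEvent ends a₁ a₂ a₃ ∩ connEvent ends a₁ b) * (prob (Function.update p e 0) (PDEvent ends a₁ a₂ a₃) + prob (Function.update p e 0) (TEvent ends a₂ a₁ a₃))) := by linarith [G2]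
  have hA := mul_nonneg (mul_nonneg (mul_nonneg (mul_nonneg (zero_le_two : (0 : R) ≤ 2) hQ0) ht) h1)
    (add_nonneg (mul_nonneg hd h2) (mul_nonneg hQ1 h3))
  have hB := mul_nonneg (mul_nonneg (mul_nonneg (mul_nonneg (zero_le_two : (0 : R) ≤ 2)
    (sq_nonneg (prob (Function.update p e 1) (avoidAll ends a₂ {a₁})))) htp) h4) (add_nonneg h5 h6)
  exact mul_nonneg hd (add_nonneg hA hB)

/-- **`0 ≤ H2` at a root edge from the within-form**: in the non-degenerate case (`0 < D₀, t, t′, Q₀`), if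
`0 ≤ Q₁²·KW + surplus + D₀·t·t′·(Q₀·A·slackBm + 2·Q₁·df·δ_oL^T)` then `0 ≤ H2`. The hypothesis is the face
of record with its product term absorbed: the only possibly negative term is the within-world part `KW`. -/
theorem H2_nonneg_root_of_within (p : E → R) (hp : IsProbVec p) (hends : ends e = s(a₁, a₃))
    (o a₂ b : V) (hd : 0 < prob (Function.update p e 0) (PDEvent ends a₁ a₂ a₃)) (ht : 0 < prob (Function.update p e 0) (TEvent ends a₁ a₂ a₃)) (htp : 0 < prob (Function.update p e 0) (TEvent ends a₂ a₁ a₃)) (hQ : 0 < prob (Function.update p e 0) (avoidAll ends a₂ {a₁}))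
    (hwithin : 0 ≤ prob (Function.update p e 1) (avoidAll ends a₂ {a₁}) ^ 2 * prob (Function.update p e 0) (PDEvent ends a₁ a₂ a₃) * prob (Function.update p e 0) (avoidAll ends a₂ {a₁}) * (prob (Function.update p e 0) (TEvent ends a₁ a₂ a₃) * prob (Function.update p e 0) (TEvent ends a₂ a₁ a₃) * (prob (Function.update p e 0) (PDEvent ends a₁ a₂ a₃) * (prob (Function.update p e 0) (PDEvent ends a₁ a₂ a₃ ∩ (connEvent ends a₁ o ∩ connEvent ends a₁ b)) + prob (Function.update p e 0) (PDEvent ends a₁ a₂ a₃ ∩ (connEvent ends a₂ o ∩ connEvent ends a₂ b)) - prob (Function.update p e 0) (PDEvent ends a₁ a₂ a₃ ∩ (connEvent ends a₂ o ∩ connEvent ends a₁ b)) - prob (Function.update p e 0) (PDEvent ends a₁ a₂ a₃ ∩ (connEvent ends a₁ o ∩ connEvent ends a₂ b))) - (prob (Function.update p e 0) (PDEvent ends a₁ a₂ a₃ ∩ connEvent ends a₁ b) - prob (Function.update p e 0) (PDEvent ends a₁ a₂ a₃ ∩ connEvent ends a₂ b)) * (prob (Function.update p e 0) (PDEvent ends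 a₁ a₂ a₃ ∩ connEvent ends a₁ o) - prob (Function.update p e 0) (PDEvent ends a₁ a₂ a₃ ∩ connEvent ends a₂ o)) - prob (Function.update p e 0) (PDEvent ends a₁ a₂ a₃) * (prob (Function.update p e 0) (PDEvent ends a₁ a₂ a₃ ∩ (connEvent ends a₁ o ∩ connEvent ends a₁ b)) + prob (Function.update p e 0) (PDEvent ends a₁ a₂ a₃ ∩ (connEvent ends a₂ o ∩ connEvent ends a₂ b)) + prob (Function.update p e 0) (PDEvent ends a₁ a₂ a₃ ∩ (connEvent ends a₂ o ∩ connEvent ends a₁ b)) + prob (Function.update p e 0) (PDEvent ends a₁ a₂ a₃ ∩ (connEvent ends a₁ o ∩ connEvent ends a₂ b))) + (prob (Function.update p e 0) (PDEvent ends a₁ a₂ a₃ ∩ connEvent ends a₁ b) + prob (Function.update p e 0) (PDEvent ends a₁ a₂ a₃ ∩ connEvent ends a₂ b)) * (prob (Function.update p e 0) (PDEvent ends a₁ a₂ a₃ ∩ connEvent ends a₁ o) + prob (Function.update p e 0) (PDEvent ends a₁ a₂ a₃ ∩ connEvent ends a₂ o))) - 2 * prob (Function.update p e 0) (PDEvent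 ends a₁ a₂ a₃) * prob (Function.update p e 0) (TEvent ends a₁ a₂ a₃) * (prob (Function.update p e 0) (TEvent ends a₂ a₁ a₃) * (prob (Function.update p e 0) (TEvent ends a₂ a₁ a₃ ∩ (connEvent ends a₂ o ∩ connEvent ends a₁ b)) - prob (Function.update p e 0) (TEvent ends a₂ a₁ a₃ ∩ (connEvent ends a₂ o ∩ connEvent ends a₂ b))) - (prob (Function.update p e 0) (TEvent ends a₂ a₁ a₃ ∩ connEvent ends a₁ b) - prob (Function.update p e 0) (TEvent ends a₂ a₁ a₃ ∩ connEvent ends a₂ b)) * prob (Function.update p e 0) (TEvent ends a₂ a₁ a₃ ∩ connEvent ends a₂ o)) + 2 * prob (Function.update p e 0) (PDEvent ends a₁ a₂ a₃) * prob (Function.update p e 0) (TEvent ends a₂ a₁ a₃) * (prob (Function.update p e 0) (TEvent ends a₁ a₂ a₃) * (prob (Function.update p e 0) (TEvent ends a₁ a₂ a₃ ∩ (connEvent ends a₁ o ∩ connEvent ends a₁ b)) - prob (Function.update p e 0) (TEvent ends a₁ a₂ a₃ ∩ (connEvent ends a₁ o ∩ connEvent ends a₂ b))) - (prob (Function.update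 p e 0) (TEvent ends a₁ a₂ a₃ ∩ connEvent ends a₁ b) - prob (Function.update p e 0) (TEvent ends a₁ a₂ a₃ ∩ connEvent ends a₂ b)) * prob (Function.update p e 0) (TEvent ends a₁ a₂ a₃ ∩ connEvent ends a₁ o))) + prob (Function.update p e 0) (PDEvent ends a₁ a₂ a₃) * (2 * prob (Function.update p e 0) (avoidAll ends a₂ {a₁}) * prob (Function.update p e 0) (TEvent ends a₁ a₂ a₃) * (prob (Function.update p e 0) (PDEvent ends a₁ a₂ a₃ ∩ connEvent ends a₂ o) * prob (Function.update p e 0) (TEvent ends a₂ a₁ a₃) - prob (Function.update p e 0) (PDEvent ends a₁ a₂ a₃) * prob (Function.update p e 0) (TEvent ends a₂ a₁ a₃ ∩ connEvent ends a₂ o)) * (prob (Function.update p e 0) (PDEvent ends a₁ a₂ a₃) * (prob (Function.update p e 0) (TEvent ends a₂ a₁ a₃) * prob (Function.update p e 0) (PDEvent ends a₁ a₂ a₃ ∩ connEvent ends a₂ b) - prob (Function.update p e 0) (PDEvent ends a₁ a₂ a₃) * prob (Function.update p e 0) (TEvent ends a₂ a₁ a₃ ∩ connEvent ends a₂ b))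 + prob (Function.update p e 1) (avoidAll ends a₂ {a₁}) * (prob (Function.update p e 0) (PDEvent ends a₁ a₂ a₃) * prob (Function.update p e 0) (TEvent ends a₂ a₁ a₃ ∩ connEvent ends a₁ b) - prob (Function.update p e 0) (PDEvent ends a₁ a₂ a₃ ∩ connEvent ends a₁ b) * prob (Function.update p e 0) (TEvent ends a₂ a₁ a₃))) + 2 * prob (Function.update p e 1) (avoidAll ends a₂ {a₁}) ^ 2 * prob (Function.update p e 0) (TEvent ends a₂ a₁ a₃) * (prob (Function.update p e 0) (PDEvent ends a₁ a₂ a₃ ∩ connEvent ends a₁ o) * prob (Function.update p e 0) (TEvent ends a₁ a₂ a₃) - prob (Function.update p e 0) (PDEvent ends a₁ a₂ a₃) * prob (Function.update p e 0) (TEvent ends a₁ a₂ a₃ ∩ connEvent ends a₁ o)) * ((prob (Function.update p e 0) (TEvent ends a₁ a₂ a₃ ∩ connEvent ends a₂ b) * (prob (Function.update p e 0) (PDEvent ends a₁ a₂ a₃) + prob (Function.update p e 0) (TEvent ends a₂ a₁ a₃)) - prob (Function.update p e 0) (TEvent ends a₁ a₂ a₃) * (prob (Function.update p e 0) (PDEvent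 ends a₁ a₂ a₃ ∩ connEvent ends a₂ b) + prob (Function.update p e 0) (TEvent ends a₂ a₁ a₃ ∩ connEvent ends a₂ b))) + (prob (Function.update p e 0) (TEvent ends a₁ a₂ a₃) * (prob (Function.update p e 0) (PDEvent ends a₁ a₂ a₃ ∩ connEvent ends a₁ b) + prob (Function.update p e 0) (TEvent ends a₂ a₁ a₃ ∩ connEvent ends a₁ b)) - prob (Function.update p e 0) (TEvent ends a₁ a₂ a₃ ∩ connEvent ends a₁ b) * (prob (Function.update p e 0) (PDEvent ends a₁ a₂ a₃) + prob (Function.update p e 0) (TEvent ends a₂ a₁ a₃))))) +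
      prob (Function.update p e 0) (PDEvent ends a₁ a₂ a₃) * prob (Function.update p e 0) (TEvent ends a₁ a₂ a₃) * prob (Function.update p e 0) (TEvent ends a₂ a₁ a₃) * (prob (Function.update p e 0) (avoidAll ends a₂ {a₁}) * (prob (Function.update p e 0) (PDEvent ends a₁ a₂ a₃) * prob (Function.update p e 0) (PDEvent ends a₁ a₂ a₃ ∩ connEvent ends a₃ o) + (prob (Function.update p e 0) (PDEvent ends a₁ a₂ a₃) * prob (Function.update p e 0) (TEvent ends a₂ a₁ a₃ ∩ connEvent ends a₁ o) - prob (Function.update p e 0) (PDEvent ends a₁ a₂ a₃ ∩ connEvent ends a₁ o) * prob (Function.update p e 0) (TEvent ends a₂ a₁ a₃))) * (2 * ((prob (Function.update p e 0) (TEvent ends a₁ a₂ a₃ ∩ connEvent ends a₂ b) * (prob (Function.update p e 0) (PDEvent ends a₁ a₂ a₃) + prob (Function.update p e 0) (TEvent ends a₂ a₁ a₃)) - prob (Function.update p e 0) (TEvent ends a₁ a₂ a₃) * (prob (Function.update p e 0) (PDEvent ends a₁ a₂ a₃ ∩ connEvent ends a₂ b) + prob (Function.update p e 0) (TEvent ends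 a₂ a₁ a₃ ∩ connEvent ends a₂ b))) + (prob (Function.update p e 0) (TEvent ends a₁ a₂ a₃) * (prob (Function.update p e 0) (PDEvent ends a₁ a₂ a₃ ∩ connEvent ends a₁ b) + prob (Function.update p e 0) (TEvent ends a₂ a₁ a₃ ∩ connEvent ends a₁ b)) - prob (Function.update p e 0) (TEvent ends a₁ a₂ a₃ ∩ connEvent ends a₁ b) * (prob (Function.update p e 0) (PDEvent ends a₁ a₂ a₃) + prob (Function.update p e 0) (TEvent ends a₂ a₁ a₃))) + (prob (Function.update p e 0) (TEvent ends a₂ a₁ a₃) * prob (Function.update p e 0) (PDEvent ends a₁ a₂ a₃ ∩ connEvent ends a₂ b) - prob (Function.update p e 0) (PDEvent ends a₁ a₂ a₃) * prob (Function.update p e 0) (TEvent ends a₂ a₁ a₃ ∩ connEvent ends a₂ b)) + (prob (Function.update p e 0) (TEvent ends a₁ a₂ a₃) * prob (Function.update p e 0) (PDEvent ends a₁ a₂ a₃ ∩ connEvent ends a₃ b)))) + 2 * prob (Function.update p e 1) (avoidAll ends a₂ {a₁}) * (prob (Function.update p e 0) (avoidAll ends a₂ {a₁}) * (prob (Function.update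 p e 1) (avoidAll ends a₂ {a₁} ∩ connEvent ends a₁ b) - prob (Function.update p e 1) (avoidAll ends a₂ {a₁} ∩ connEvent ends a₂ b)) - prob (Function.update p e 1) (avoidAll ends a₂ {a₁}) * (prob (Function.update p e 0) (avoidAll ends a₂ {a₁} ∩ connEvent ends a₁ b) - prob (Function.update p e 0) (avoidAll ends a₂ {a₁} ∩ connEvent ends a₂ b))) * (prob (Function.update p e 0) (PDEvent ends a₁ a₂ a₃ ∩ connEvent ends a₁ o) * prob (Function.update p e 0) (TEvent ends a₁ a₂ a₃) - prob (Function.update p e 0) (PDEvent ends a₁ a₂ a₃) * prob (Function.update p e 0) (TEvent ends a₁ a₂ a₃ ∩ connEvent ends a₁ o)))) :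
    0 ≤ H2 p ends o a₁ a₂ a₃ b e := by
  have hB2 := B2_nonneg_root p hp hends o a₂ b
  have hB2e := B2_eq_root p hends o a₂ b
  have hsigned := Q0_mul_H2_root_signed p hends o a₂ b
  have hwf := Gc0_within_form p hends o a₂ b
  have hg : 0 ≤ 2 * prob (Function.update p e 0) (PDEvent ends a₁ a₂ a₃) * prob (Function.update p e 0) (avoidAll ends a₂ {a₁}) ^ 2 * (-2 * (prob (Function.update p e 1) (avoidAll ends a₂ {a₁}) * (prob (Function.update p e 1) (avoidAll ends a₂ {a₁} ∩ (connEvent ends a₂ o ∩ connEvent ends a₁ b)) - prob (Function.update p e 1) (avoidAll ends a₂ {a₁} ∩ (connEvent ends a₂ o ∩ connEvent ends a₂ b))) - (prob (Function.update p e 1) (avoidAll ends a₂ {a₁} ∩ connEvent ends a₁ b) - prob (Function.update p e 1) (avoidAll ends a₂ {a₁} ∩ connEvent ends a₂ b)) * prob (Function.update p e 1) (avoidAll ends a₂ {a₁} ∩ connEvent ends a₂ o))) := by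
    have := mul_nonneg (mul_nonneg (by norm_num : (0 : R) ≤ 2) (sq_nonneg (prob (Function.update p e 0) (avoidAll ends a₂ {a₁})))) hB2
    rw [hB2e] at this
    linarith [this]
  have hdtt : 0 < prob (Function.update p e 0) (PDEvent ends a₁ a₂ a₃) * prob (Function.update p e 0) (TEvent ends a₁ a₂ a₃) * prob (Function.update p e 0) (TEvent ends a₂ a₁ a₃) := mul_pos (mul_pos hd ht) htp
  have hpos : 0 < prob (Function.update p e 0) (PDEvent ends a₁ a₂ a₃) * prob (Function.update p e 0) (TEvent ends a₁ a₂ a₃) * prob (Function.update p e 0) (TEvent ends a₂ a₁ a₃) * prob (Function.update p e 0) (avoidAll ends a₂ {a₁}) := mul_pos hdtt hQ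
  have key : prob (Function.update p e 0) (PDEvent ends a₁ a₂ a₃) * prob (Function.update p e 0) (TEvent ends a₁ a₂ a₃) * prob (Function.update p e 0) (TEvent ends a₂ a₁ a₃) * prob (Function.update p e 0) (avoidAll ends a₂ {a₁}) * H2 p ends o a₁ a₂ a₃ b e =
      prob (Function.update p e 0) (PDEvent ends a₁ a₂ a₃) * prob (Function.update p e 0) (TEvent ends a₁ a₂ a₃) * prob (Function.update p e 0) (TEvent ends a₂ a₁ a₃) * (2 * prob (Function.update p e 0) (PDEvent ends a₁ a₂ a₃) * prob (Function.update p e 0) (avoidAll ends a₂ {a₁}) ^ 2 * (-2 * (prob (Function.update p e 1) (avoidAll ends a₂ {a₁}) * (prob (Function.update p e 1) (avoidAll ends a₂ {a₁} ∩ (connEvent ends a₂ o ∩ connEvent ends a₁ b)) - prob (Function.update p e 1) (avoidAll ends a₂ {a₁} ∩ (connEvent ends a₂ o ∩ connEvent ends a₂ b))) - (prob (Function.update p e 1) (avoidAll ends a₂ {a₁} ∩ connEvent ends a₁ b) - prob (Function.update p e 1) (avoidAll ends a₂ {a₁} ∩ connEvent ends a₂ b)) * prob (Function.update p e 1) (avoidAll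 ends a₂ {a₁} ∩ connEvent ends a₂ o)))) +
        (prob (Function.update p e 1) (avoidAll ends a₂ {a₁}) ^ 2 * prob (Function.update p e 0) (PDEvent ends a₁ a₂ a₃) * prob (Function.update p e 0) (avoidAll ends a₂ {a₁}) * (prob (Function.update p e 0) (TEvent ends a₁ a₂ a₃) * prob (Function.update p e 0) (TEvent ends a₂ a₁ a₃) * (prob (Function.update p e 0) (PDEvent ends a₁ a₂ a₃) * (prob (Function.update p e 0) (PDEvent ends a₁ a₂ a₃ ∩ (connEvent ends a₁ o ∩ connEvent ends a₁ b)) + prob (Function.update p e 0) (PDEvent ends a₁ a₂ a₃ ∩ (connEvent ends a₂ o ∩ connEvent ends a₂ b)) - prob (Function.update p e 0) (PDEvent ends a₁ a₂ a₃ ∩ (connEvent ends a₂ o ∩ connEvent ends a₁ b)) - prob (Function.update p e 0) (PDEvent ends a₁ a₂ a₃ ∩ (connEvent ends a₁ o ∩ connEvent ends a₂ b))) - (prob (Function.update p e 0) (PDEvent ends a₁ a₂ a₃ ∩ connEvent ends a₁ b) - prob (Function.update p e 0) (PDEvent ends a₁ a₂ a₃ ∩ connEvent ends a₂ b)) * (prob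 (Function.update p e 0) (PDEvent ends a₁ a₂ a₃ ∩ connEvent ends a₁ o) - prob (Function.update p e 0) (PDEvent ends a₁ a₂ a₃ ∩ connEvent ends a₂ o)) - prob (Function.update p e 0) (PDEvent ends a₁ a₂ a₃) * (prob (Function.update p e 0) (PDEvent ends a₁ a₂ a₃ ∩ (connEvent ends a₁ o ∩ connEvent ends a₁ b)) + prob (Function.update p e 0) (PDEvent ends a₁ a₂ a₃ ∩ (connEvent ends a₂ o ∩ connEvent ends a₂ b)) + prob (Function.update p e 0) (PDEvent ends a₁ a₂ a₃ ∩ (connEvent ends a₂ o ∩ connEvent ends a₁ b)) + prob (Function.update p e 0) (PDEvent ends a₁ a₂ a₃ ∩ (connEvent ends a₁ o ∩ connEvent ends a₂ b))) + (prob (Function.update p e 0) (PDEvent ends a₁ a₂ a₃ ∩ connEvent ends a₁ b) + prob (Function.update p e 0) (PDEvent ends a₁ a₂ a₃ ∩ connEvent ends a₂ b)) * (prob (Function.update p e 0) (PDEvent ends a₁ a₂ a₃ ∩ connEvent ends a₁ o) + prob (Function.update p e 0) (PDEvent ends a₁ a₂ a₃ ∩ connEvent ends a₂ o))) - 2 *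 prob (Function.update p e 0) (PDEvent ends a₁ a₂ a₃) * prob (Function.update p e 0) (TEvent ends a₁ a₂ a₃) * (prob (Function.update p e 0) (TEvent ends a₂ a₁ a₃) * (prob (Function.update p e 0) (TEvent ends a₂ a₁ a₃ ∩ (connEvent ends a₂ o ∩ connEvent ends a₁ b)) - prob (Function.update p e 0) (TEvent ends a₂ a₁ a₃ ∩ (connEvent ends a₂ o ∩ connEvent ends a₂ b))) - (prob (Function.update p e 0) (TEvent ends a₂ a₁ a₃ ∩ connEvent ends a₁ b) - prob (Function.update p e 0) (TEvent ends a₂ a₁ a₃ ∩ connEvent ends a₂ b)) * prob (Function.update p e 0) (TEvent ends a₂ a₁ a₃ ∩ connEvent ends a₂ o)) + 2 * prob (Function.update p e 0) (PDEvent ends a₁ a₂ a₃) * prob (Function.update p e 0) (TEvent ends a₂ a₁ a₃) * (prob (Function.update p e 0) (TEvent ends a₁ a₂ a₃) * (prob (Function.update p e 0) (TEvent ends a₁ a₂ a₃ ∩ (connEvent ends a₁ o ∩ connEvent ends a₁ b)) - prob (Function.update p e 0) (TEvent ends a₁ a₂ a₃ ∩ (connEvent ends a₁ o ∩ connEvent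 ends a₂ b))) - (prob (Function.update p e 0) (TEvent ends a₁ a₂ a₃ ∩ connEvent ends a₁ b) - prob (Function.update p e 0) (TEvent ends a₁ a₂ a₃ ∩ connEvent ends a₂ b)) * prob (Function.update p e 0) (TEvent ends a₁ a₂ a₃ ∩ connEvent ends a₁ o))) + prob (Function.update p e 0) (PDEvent ends a₁ a₂ a₃) * (2 * prob (Function.update p e 0) (avoidAll ends a₂ {a₁}) * prob (Function.update p e 0) (TEvent ends a₁ a₂ a₃) * (prob (Function.update p e 0) (PDEvent ends a₁ a₂ a₃ ∩ connEvent ends a₂ o) * prob (Function.update p e 0) (TEvent ends a₂ a₁ a₃) - prob (Function.update p e 0) (PDEvent ends a₁ a₂ a₃) * prob (Function.update p e 0) (TEvent ends a₂ a₁ a₃ ∩ connEvent ends a₂ o)) * (prob (Function.update p e 0) (PDEvent ends a₁ a₂ a₃) * (prob (Function.update p e 0) (TEvent ends a₂ a₁ a₃) * prob (Function.update p e 0) (PDEvent ends a₁ a₂ a₃ ∩ connEvent ends a₂ b) - prob (Function.update p e 0) (PDEvent ends a₁ a₂ a₃) * prob (Function.update p e 0) (TEvent ends a₂ a₁ a₃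 ∩ connEvent ends a₂ b)) + prob (Function.update p e 1) (avoidAll ends a₂ {a₁}) * (prob (Function.update p e 0) (PDEvent ends a₁ a₂ a₃) * prob (Function.update p e 0) (TEvent ends a₂ a₁ a₃ ∩ connEvent ends a₁ b) - prob (Function.update p e 0) (PDEvent ends a₁ a₂ a₃ ∩ connEvent ends a₁ b) * prob (Function.update p e 0) (TEvent ends a₂ a₁ a₃))) + 2 * prob (Function.update p e 1) (avoidAll ends a₂ {a₁}) ^ 2 * prob (Function.update p e 0) (TEvent ends a₂ a₁ a₃) * (prob (Function.update p e 0) (PDEvent ends a₁ a₂ a₃ ∩ connEvent ends a₁ o) * prob (Function.update p e 0) (TEvent ends a₁ a₂ a₃) - prob (Function.update p e 0) (PDEvent ends a₁ a₂ a₃) * prob (Function.update p e 0) (TEvent ends a₁ a₂ a₃ ∩ connEvent ends a₁ o)) * ((prob (Function.update p e 0) (TEvent ends a₁ a₂ a₃ ∩ connEvent ends a₂ b) * (prob (Function.update p e 0) (PDEvent ends a₁ a₂ a₃) + prob (Function.update p e 0) (TEvent ends a₂ a₁ a₃)) - prob (Function.update p e 0) (TEvent ends a₁ a₂ a₃) *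 (prob (Function.update p e 0) (PDEvent ends a₁ a₂ a₃ ∩ connEvent ends a₂ b) + prob (Function.update p e 0) (TEvent ends a₂ a₁ a₃ ∩ connEvent ends a₂ b))) + (prob (Function.update p e 0) (TEvent ends a₁ a₂ a₃) * (prob (Function.update p e 0) (PDEvent ends a₁ a₂ a₃ ∩ connEvent ends a₁ b) + prob (Function.update p e 0) (TEvent ends a₂ a₁ a₃ ∩ connEvent ends a₁ b)) - prob (Function.update p e 0) (TEvent ends a₁ a₂ a₃ ∩ connEvent ends a₁ b) * (prob (Function.update p e 0) (PDEvent ends a₁ a₂ a₃) + prob (Function.update p e 0) (TEvent ends a₂ a₁ a₃))))) + prob (Function.update p e 0) (PDEvent ends a₁ a₂ a₃) * prob (Function.update p e 0) (TEvent ends a₁ a₂ a₃) * prob (Function.update p e 0) (TEvent ends a₂ a₁ a₃) * (prob (Function.update p e 0) (avoidAll ends a₂ {a₁}) * (prob (Function.update p e 0) (PDEvent ends a₁ a₂ a₃) * prob (Function.update p e 0) (PDEvent ends a₁ a₂ a₃ ∩ connEvent ends a₃ o) + (prob (Function.update p e 0) (PDEvent ends a₁ a₂ a₃) * prob (Function.update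 p e 0) (TEvent ends a₂ a₁ a₃ ∩ connEvent ends a₁ o) - prob (Function.update p e 0) (PDEvent ends a₁ a₂ a₃ ∩ connEvent ends a₁ o) * prob (Function.update p e 0) (TEvent ends a₂ a₁ a₃))) * (2 * ((prob (Function.update p e 0) (TEvent ends a₁ a₂ a₃ ∩ connEvent ends a₂ b) * (prob (Function.update p e 0) (PDEvent ends a₁ a₂ a₃) + prob (Function.update p e 0) (TEvent ends a₂ a₁ a₃)) - prob (Function.update p e 0) (TEvent ends a₁ a₂ a₃) * (prob (Function.update p e 0) (PDEvent ends a₁ a₂ a₃ ∩ connEvent ends a₂ b) + prob (Function.update p e 0) (TEvent ends a₂ a₁ a₃ ∩ connEvent ends a₂ b))) + (prob (Function.update p e 0) (TEvent ends a₁ a₂ a₃) * (prob (Function.update p e 0) (PDEvent ends a₁ a₂ a₃ ∩ connEvent ends a₁ b) + prob (Function.update p e 0) (TEvent ends a₂ a₁ a₃ ∩ connEvent ends a₁ b)) - prob (Function.update p e 0) (TEvent ends a₁ a₂ a₃ ∩ connEvent ends a₁ b) * (prob (Function.update p e 0) (PDEvent ends a₁ a₂ a₃) + prob (Function.update p e 0)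 (TEvent ends a₂ a₁ a₃))) + (prob (Function.update p e 0) (TEvent ends a₂ a₁ a₃) * prob (Function.update p e 0) (PDEvent ends a₁ a₂ a₃ ∩ connEvent ends a₂ b) - prob (Function.update p e 0) (PDEvent ends a₁ a₂ a₃) * prob (Function.update p e 0) (TEvent ends a₂ a₁ a₃ ∩ connEvent ends a₂ b)) + (prob (Function.update p e 0) (TEvent ends a₁ a₂ a₃) * prob (Function.update p e 0) (PDEvent ends a₁ a₂ a₃ ∩ connEvent ends a₃ b)))) + 2 * prob (Function.update p e 1) (avoidAll ends a₂ {a₁}) * (prob (Function.update p e 0) (avoidAll ends a₂ {a₁}) * (prob (Function.update p e 1) (avoidAll ends a₂ {a₁} ∩ connEvent ends a₁ b) - prob (Function.update p e 1) (avoidAll ends a₂ {a₁} ∩ connEvent ends a₂ b)) - prob (Function.update p e 1) (avoidAll ends a₂ {a₁}) * (prob (Function.update p e 0) (avoidAll ends a₂ {a₁} ∩ connEvent ends a₁ b) - prob (Function.update p e 0) (avoidAll ends a₂ {a₁} ∩ connEvent ends a₂ b))) * (prob (Function.update p e 0) (PDEvent ends a₁ a₂ a₃ ∩ connEvent ends a₁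 o) * prob (Function.update p e 0) (TEvent ends a₁ a₂ a₃) - prob (Function.update p e 0) (PDEvent ends a₁ a₂ a₃) * prob (Function.update p e 0) (TEvent ends a₁ a₂ a₃ ∩ connEvent ends a₁ o)))) := by
    calc prob (Function.update p e 0) (PDEvent ends a₁ a₂ a₃) * prob (Function.update p e 0) (TEvent ends a₁ a₂ a₃) * prob (Function.update p e 0) (TEvent ends a₂ a₁ a₃) * prob (Function.update p e 0) (avoidAll ends a₂ {a₁}) * H2 p ends o a₁ a₂ a₃ b e
        = prob (Function.update p e 0) (PDEvent ends a₁ a₂ a₃) * prob (Function.update p e 0) (TEvent ends a₁ a₂ a₃) * prob (Function.update p e 0) (TEvent ends a₂ a₁ a₃) * (prob (Function.update p e 0) (avoidAll ends a₂ {a₁}) * H2 p ends o a₁ a₂ a₃ b e) := by ring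
      _ = _ := by rw [hsigned]; linear_combination hwf
  have hQH : prob (Function.update p e 0) (PDEvent ends a₁ a₂ a₃) * prob (Function.update p e 0) (TEvent ends a₁ a₂ a₃) * prob (Function.update p e 0) (TEvent ends a₂ a₁ a₃) * prob (Function.update p e 0) (avoidAll ends a₂ {a₁}) * 0 ≤ prob (Function.update p e 0) (PDEvent ends a₁ a₂ a₃) * prob (Function.update p e 0) (TEvent ends a₁ a₂ a₃) * prob (Function.update p e 0) (TEvent ends a₂ a₁ a₃) * prob (Function.update p e 0) (avoidAll ends a₂ {a₁}) * H2 p ends o a₁ a₂ a₃ b e := by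
    rw [mul_zero, key]; exact add_nonneg (mul_nonneg hdtt.le hg) hwithin
  exact le_of_mul_le_mul_left hQH hpos

/-- **The product term is non-negative**: `0 ≤ NEG = 2·δ_oH·[Q₀·δ_bH + Q₁·(G1 + G2)]` (the deficits and the pieces
`G1, G2` are `≥ 0`). -/
theorem NEG_nonneg_root (p : E → R) (hp : IsProbVec p) (o a₂ b : V) :
    0 ≤ 2 * (prob (Function.update p e 0) (PDEvent ends a₁ a₂ a₃ ∩ connEvent ends a₂ o) * prob (Function.update p e 0) (TEvent ends a₂ a₁ a₃) - prob (Function.update p e 0) (PDEvent ends a₁ a₂ a₃) * prob (Function.update p e 0) (TEvent ends a₂ a₁ a₃ ∩ connEvent ends a₂ o)) * (prob (Function.update p e 0) (avoidAll ends a₂ {a₁}) * (prob (Function.update p e 0) (TEvent ends a₂ a₁ a₃) * prob (Function.update p e 0) (PDEvent ends a₁ a₂ a₃ ∩ connEvent ends a₂ b) - prob (Function.update p e 0) (PDEvent ends a₁ a₂ a₃) * prob (Function.update p e 0) (TEvent ends a₂ a₁ a₃ ∩ connEvent ends a₂ b)) + prob (Function.update p e 1) (avoidAll ends a₂ {a₁})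 * ((prob (Function.update p e 0) (TEvent ends a₁ a₂ a₃ ∩ connEvent ends a₂ b) * (prob (Function.update p e 0) (PDEvent ends a₁ a₂ a₃) + prob (Function.update p e 0) (TEvent ends a₂ a₁ a₃)) - prob (Function.update p e 0) (TEvent ends a₁ a₂ a₃) * (prob (Function.update p e 0) (PDEvent ends a₁ a₂ a₃ ∩ connEvent ends a₂ b) + prob (Function.update p e 0) (TEvent ends a₂ a₁ a₃ ∩ connEvent ends a₂ b))) + (prob (Function.update p e 0) (TEvent ends a₁ a₂ a₃) * (prob (Function.update p e 0) (PDEvent ends a₁ a₂ a₃ ∩ connEvent ends a₁ b) + prob (Function.update p e 0) (TEvent ends a₂ a₁ a₃ ∩ connEvent ends a₁ b)) - prob (Function.update p e 0) (TEvent ends a₁ a₂ a₃ ∩ connEvent ends a₁ b) * (prob (Function.update p e 0) (PDEvent ends a₁ a₂ a₃) + prob (Function.update p e 0) (TEvent ends a₂ a₁ a₃))))) := by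
  have hp₀ : IsProbVec (Function.update p e 0) := hp.update e le_rfl zero_le_one
  have hQ0 := prob_nonneg hp₀ (avoidAll ends a₂ {a₁})
  have hQ1 := prob_nonneg (hp.update e zero_le_one le_rfl : IsProbVec (Function.update p e 1)) (avoidAll ends a₂ {a₁})
  have hoH := DiagBA3.T'oH_mul_D_le (Function.update p e 0) hp₀ ends o a₁ a₂ a₃
  have hbH := DiagBA3.T'oH_mul_D_le (Function.update p e 0) hp₀ ends b a₁ a₂ a₃
  have G1 := QbH_mul_T_le (Function.update p e 0) hp₀ ends a₁ a₂ a₃ b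
  rw [Qsplit_univ (Function.update p e 0) ends a₁ a₂ a₃,
    Qsplit (Function.update p e 0) ends a₁ a₂ a₃ (connEvent ends a₂ b)] at G1
  have G2 := A3Inactive.bLoH_mul_Q_le (Function.update p e 0) hp₀ ends a₃ a₁ a₂ b
  rw [Q_inter_conn_a2_a3_inter ends a₁ a₂ a₃ (connEvent ends a₁ b),
    Qsplit_univ (Function.update p e 0) ends a₁ a₂ a₃,
    Qsplit (Function.update p e 0) ends a₁ a₂ a₃ (connEvent ends a₁ b)] at G2
  have eT : avoidAll ends a₂ {a₁} ∩ connEvent ends a₂ a₃ = TEvent ends a₁ a₂ a₃ := by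
    rw [TEvent, avoidAll_eq_compl]
  rw [eT] at G2
  have h1 : 0 ≤ (prob (Function.update p e 0) (PDEvent ends a₁ a₂ a₃ ∩ connEvent ends a₂ o) * prob (Function.update p e 0) (TEvent ends a₂ a₁ a₃) - prob (Function.update p e 0) (PDEvent ends a₁ a₂ a₃) * prob (Function.update p e 0) (TEvent ends a₂ a₁ a₃ ∩ connEvent ends a₂ o)) := by linarith [hoH]
  have h2 : 0 ≤ (prob (Function.update p e 0) (TEvent ends a₂ a₁ a₃) * prob (Function.update p e 0) (PDEvent ends a₁ a₂ a₃ ∩ connEvent ends a₂ b) - prob (Function.update p e 0) (PDEvent ends a₁ a₂ a₃) * prob (Function.update p e 0) (TEvent ends a₂ a₁ a₃ ∩ connEvent ends a₂ b)) := by linarith [hbH]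
  have h5 : 0 ≤ (prob (Function.update p e 0) (TEvent ends a₁ a₂ a₃ ∩ connEvent ends a₂ b) * (prob (Function.update p e 0) (PDEvent ends a₁ a₂ a₃) + prob (Function.update p e 0) (TEvent ends a₂ a₁ a₃)) - prob (Function.update p e 0) (TEvent ends a₁ a₂ a₃) * (prob (Function.update p e 0) (PDEvent ends a₁ a₂ a₃ ∩ connEvent ends a₂ b) + prob (Function.update p e 0) (TEvent ends a₂ a₁ a₃ ∩ connEvent ends a₂ b))) := by linarith [G1]
  have h6 : 0 ≤ (prob (Function.update p e 0) (TEvent ends a₁ a₂ a₃) * (prob (Function.update p e 0) (PDEvent ends a₁ a₂ a₃ ∩ connEvent ends a₁ b) + prob (Function.update p e 0) (TEvent ends a₂ a₁ a₃ ∩ connEvent ends a₁ b)) - prob (Function.update p e 0) (TEvent ends a₁ a₂ a₃ ∩ connEvent ends a₁ b) * (prob (Function.update p e 0) (PDEvent ends a₁ a₂ a₃) + prob (Function.update p e 0) (TEvent ends a₂ a₁ a₃))) := by linarith [G2]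
  exact mul_nonneg (mul_nonneg (zero_le_two : (0 : R) ≤ 2) h1)
    (add_nonneg (mul_nonneg hQ0 h2) (mul_nonneg hQ1 (add_nonneg h5 h6)))

/-- **The between-world part of the kernel is non-negative** (division-free): `Q₁²·KW ≤ D₀·t·t′·Q₁²·Gc₀`, i.e.
`0 ≤ Q₁²·t·t′·D₀²·Q₀²·Between` — the «nonnegative between-world piece» of the a₃-exploration reading is a
theorem: it equals `D₀·t·t′·NEG + surplus` with both terms `≥ 0`. -/
theorem between_part_nonneg_root (p : E → R) (hp : IsProbVec p) (hends : ends e = s(a₁, a₃)) (o a₂ b : V) :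
    prob (Function.update p e 1) (avoidAll ends a₂ {a₁}) ^ 2 * prob (Function.update p e 0) (PDEvent ends a₁ a₂ a₃) * prob (Function.update p e 0) (avoidAll ends a₂ {a₁}) * (prob (Function.update p e 0) (TEvent ends a₁ a₂ a₃) * prob (Function.update p e 0) (TEvent ends a₂ a₁ a₃) * (prob (Function.update p e 0) (PDEvent ends a₁ a₂ a₃) * (prob (Function.update p e 0) (PDEvent ends a₁ a₂ a₃ ∩ (connEvent ends a₁ o ∩ connEvent ends a₁ b)) + prob (Function.update p e 0) (PDEvent ends a₁ a₂ a₃ ∩ (connEvent ends a₂ o ∩ connEvent ends a₂ b)) - prob (Function.update p e 0) (PDEvent ends a₁ a₂ a₃ ∩ (connEvent ends a₂ o ∩ connEvent ends a₁ b)) - prob (Function.update p e 0) (PDEvent ends a₁ a₂ a₃ ∩ (connEvent ends a₁ o ∩ connEvent ends a₂ b))) - (prob (Function.update p e 0) (PDEvent ends a₁ a₂ a₃ ∩ connEvent ends a₁ b) - prob (Function.update p e 0) (PDEvent ends a₁ a₂ a₃ ∩ connEvent ends a₂ b)) * (prob (Function.update p e 0) (PDEvent ends a₁ a₂ a₃ ∩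 connEvent ends a₁ o) - prob (Function.update p e 0) (PDEvent ends a₁ a₂ a₃ ∩ connEvent ends a₂ o)) - prob (Function.update p e 0) (PDEvent ends a₁ a₂ a₃) * (prob (Function.update p e 0) (PDEvent ends a₁ a₂ a₃ ∩ (connEvent ends a₁ o ∩ connEvent ends a₁ b)) + prob (Function.update p e 0) (PDEvent ends a₁ a₂ a₃ ∩ (connEvent ends a₂ o ∩ connEvent ends a₂ b)) + prob (Function.update p e 0) (PDEvent ends a₁ a₂ a₃ ∩ (connEvent ends a₂ o ∩ connEvent ends a₁ b)) + prob (Function.update p e 0) (PDEvent ends a₁ a₂ a₃ ∩ (connEvent ends a₁ o ∩ connEvent ends a₂ b))) + (prob (Function.update p e 0) (PDEvent ends a₁ a₂ a₃ ∩ connEvent ends a₁ b) + prob (Function.update p e 0) (PDEvent ends a₁ a₂ a₃ ∩ connEvent ends a₂ b)) * (prob (Function.update p e 0) (PDEvent ends a₁ a₂ a₃ ∩ connEvent ends a₁ o) + prob (Function.update p e 0) (PDEvent ends a₁ a₂ a₃ ∩ connEvent ends a₂ o))) - 2 * prob (Function.update p e 0) (PDEvent ends a₁ a₂ a₃) * prob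 (Function.update p e 0) (TEvent ends a₁ a₂ a₃) * (prob (Function.update p e 0) (TEvent ends a₂ a₁ a₃) * (prob (Function.update p e 0) (TEvent ends a₂ a₁ a₃ ∩ (connEvent ends a₂ o ∩ connEvent ends a₁ b)) - prob (Function.update p e 0) (TEvent ends a₂ a₁ a₃ ∩ (connEvent ends a₂ o ∩ connEvent ends a₂ b))) - (prob (Function.update p e 0) (TEvent ends a₂ a₁ a₃ ∩ connEvent ends a₁ b) - prob (Function.update p e 0) (TEvent ends a₂ a₁ a₃ ∩ connEvent ends a₂ b)) * prob (Function.update p e 0) (TEvent ends a₂ a₁ a₃ ∩ connEvent ends a₂ o)) + 2 * prob (Function.update p e 0) (PDEvent ends a₁ a₂ a₃) * prob (Function.update p e 0) (TEvent ends a₂ a₁ a₃) * (prob (Function.update p e 0) (TEvent ends a₁ a₂ a₃) * (prob (Function.update p e 0) (TEvent ends a₁ a₂ a₃ ∩ (connEvent ends a₁ o ∩ connEvent ends a₁ b)) - prob (Function.update p e 0) (TEvent ends a₁ a₂ a₃ ∩ (connEvent ends a₁ o ∩ connEvent ends a₂ b))) - (prob (Function.update p e 0) (TEvent ends a₁ a₂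 a₃ ∩ connEvent ends a₁ b) - prob (Function.update p e 0) (TEvent ends a₁ a₂ a₃ ∩ connEvent ends a₂ b)) * prob (Function.update p e 0) (TEvent ends a₁ a₂ a₃ ∩ connEvent ends a₁ o))) ≤ prob (Function.update p e 0) (PDEvent ends a₁ a₂ a₃) * prob (Function.update p e 0) (TEvent ends a₁ a₂ a₃) * prob (Function.update p e 0) (TEvent ends a₂ a₁ a₃) * prob (Function.update p e 1) (avoidAll ends a₂ {a₁}) ^ 2 * Gc (Function.update p e 0) ends o a₁ a₂ a₃ b := by
  have hp₀ : IsProbVec (Function.update p e 0) := hp.update e le_rfl zero_le_one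
  have hd := prob_nonneg hp₀ (PDEvent ends a₁ a₂ a₃)
  have ht := prob_nonneg hp₀ (TEvent ends a₁ a₂ a₃)
  have htp := prob_nonneg hp₀ (TEvent ends a₂ a₁ a₃)
  have hN := NEG_nonneg_root (ends := ends) (e := e) (a₁ := a₁) (a₃ := a₃) p hp o a₂ b
  have hS := surplus_nonneg_root (ends := ends) (e := e) (a₁ := a₁) (a₃ := a₃) p hp o a₂ b
  have hwf := Gc0_within_form p hends o a₂ b
  have hdtt : 0 ≤ prob (Function.update p e 0) (PDEvent ends a₁ a₂ a₃) * prob (Function.update p e 0) (TEvent ends a₁ a₂ a₃) * prob (Function.update p e 0) (TEvent ends a₂ a₁ a₃) := mul_nonneg (mul_nonneg hd ht) htp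
  rw [hwf]
  have := mul_nonneg hdtt hN
  linarith [this, hS]

end Within

end QuarticRootCross

end Summit.Ventures.PercRepro2
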